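import Mathlib
import HarnessLib
import Summits.ResolutionOfSingularities.ResolutionOfSingularities.Theorems.WildQuotientsWildQuotientResolutionS1aGoodOfKilledNode
import Summits.ResolutionOfSingularities.ResolutionOfSingularities.Theorems.WildQuotientsWildQuotientResolutionS1aJInf

/-!
# W4.5c SIG NP v2 — NODE ATLAS AS DATA and the ATLAS-RELATIVE non-principal locus (RULING R-F11 «reading = np-ATLAS», plan-1 g14)

[OURS · L1 W4.5c · plan-1 g14 SIG file — DEFINITIONS + statement Props only, no proofs; counted 0; AI-level < expert review]
Crux stmt-ResolutionOfSingularities-17941, line `s1a-logminvertex`. Companion of SIG NP v1 (`Lines/W45cNpFrameSig.lean`, the INTRINSIC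
np-∃ reading) and of the memo `Lines/s1a-logminvertex-NP-FRAME-v1.md`; the ruling R-F11 (bus 2026-08-28T17:2xZ) chooses THIS reading.

* `NodeChartData p ρ g₀ O` — the data of `IsNodeChart` (tame node `(B, 𝒜, σ)` graded by `Π j, ZMod (r j)`, `e : Γ(V, O) ≃ 𝒜 0`
  intertwining `g₀` with `σ`), bundled (`B : CommRingCat`, the grading as a field — no instances declared).
* `NodeChartData.PrincipalAt c u` — the chart's augmentation ideal becomes principal after inverting some `σ`-fixed degree-`0` element
  that is a unit at `u` («principal at every prime of `B` over the orbit of `u`»; `B` is integral over `𝒜 0`, so this is the pointwise notion).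
* `NodeAtlasData p ρ g₀` — a covering family of charts with data; `Compatible` — any two charts agree about `PrincipalAt` at common points.
* `npLocusA 𝔄 := {u | some (⟺ every, under `Compatible`) chart of 𝔄 at u is not principal at u}` — the measure's locus in the np-ATLAS game.
Port statements (kernel): NPA0 data ⇒ today's Prop atlas; NPA1 `badLocus ⊆ npLocusA` (= `isGoodAt_of_killedNode` on the localised
chart); NPA2 `npLocusA = ∅ → Terminal`; NPA3 closed. The frame change itself (GModel carries `𝔄` + `compat`; `IsMoveOf` requires the new
atlas to be compatible with the producer-step charts over the centre and with the pull-backs off it; optional refinement move) is a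
STRUCTURE EDIT owned by lead-1 ((K0-np)); its shape is recorded in the module docstring only.
-/

set_option linter.dupNamespace false

noncomputable section

namespace Summit.ResolutionOfSingularities.ResolutionOfSingularities.Theorems.WildQuotientResolution.S1

open CategoryTheory AlgebraicGeometry TopologicalSpace
open Literature.AlgebraicGeometry.Resolution Literature.AlgebraicGeometry.RelativeSpec
open Summit.ResolutionOfSingularities.ResolutionOfSingularities.Theorems.WildQuotientResolution.S1.ProducerStep
open Summit.ResolutionOfSingularities.ResolutionOfSingularities.Theorems.WildQuotientResolution.S1.NodeAtlas

namespace NodeAtlas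

section Data

variable (p : ℕ) {V Y : Scheme.{0}} {q : V ⟶ Y} {G : Type} [Group G] (ρ : ActionOver q G) (g₀ : G)

/-- **Node chart DATA** on a stable affine open `O`: the witnesses of `IsNodeChart p ρ g₀ O`, bundled. [OURS · L1 W4.5c · SIG NP v2] -/
structure NodeChartData (O : ρ.StableAffineOpens) : Type 1 where
  affine : IsAffineOpen O.1
  m : ℕ
  r : Fin m → ℕ
  B : CommRingCat.{0}
  𝒜 : (Π j : Fin m, ZMod (r j)) → AddSubgroup B
  grading : GradedRing 𝒜
  σ : B ≃+* B
  e : Γ(V, O.1) ≃+* ↥(𝒜 0)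
  tame : letI : GradedRing 𝒜 := grading; IsTameNode p B 𝒜 σ
  intertwine : ∀ t : Γ(V, O.1),
    ((e ((ρ.aut g₀⁻¹).hom.appLE O.1 O.1 (O.2.1 g₀⁻¹).ge t) : ↥(𝒜 0)) : B) = σ ((e t : ↥(𝒜 0)) : B)

variable {p ρ g₀}

/-- **Principal at `u`** (for a chart with data containing `u`): after inverting some `σ`-fixed degree-`0` element which is a unit at
`u`, the augmentation ideal of `σ` is principal. [OURS · L1 W4.5c · SIG NP v2] -/
def NodeChartData.PrincipalAt {O : ρ.StableAffineOpens} (c : NodeChartData p ρ g₀ O) (u : V) (hu : u ∈ O.1) : Prop :=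
  ∃ s : Γ(V, O.1), IsUnit (V.presheaf.germ O.1 u hu s) ∧ c.σ ((c.e s : ↥(c.𝒜 0)) : c.B) = ((c.e s : ↥(c.𝒜 0)) : c.B) ∧
    ((augmentationIdeal c.σ).map (algebraMap c.B (Localization.Away ((c.e s : ↥(c.𝒜 0)) : c.B)))).IsPrincipal

variable (p ρ g₀)

/-- **Node atlas DATA**: a covering family of stable affine opens with node chart data. [OURS · L1 W4.5c · SIG NP v2] -/
structure NodeAtlasData : Type 1 where
  ι : Type
  O : ι → ρ.StableAffineOpens
  chart : ∀ i, NodeChartData p ρ g₀ (O i)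
  cover : ∀ v : V, ∃ i, v ∈ (O i).1

variable {p ρ g₀}

/-- **Compatibility** of an atlas: two charts through a point agree on «principal at the point». It holds BY CONSTRUCTION for the atlases
the strategy maintains (charts of one blow-up node are localisations of one Rees algebra; idle charts are pulled back isomorphically; a
Laurent refinement `B[x′^{±1}]` agrees with `B` at additive points) — each an algebraic lemma of the port. [OURS · L1 W4.5c · SIG NP v2] -/
def NodeAtlasData.Compatible (𝔄 : NodeAtlasData p ρ g₀) : Prop :=
  ∀ (i j : 𝔄.ι) (u : V) (hi : u ∈ (𝔄.O i).1) (hj : u ∈ (𝔄.O j).1),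
    (𝔄.chart i).PrincipalAt u hi ↔ (𝔄.chart j).PrincipalAt u hj

/-- **The atlas-relative non-principal locus**: some chart of the atlas through `u` is not principal at `u` (equivalently every chart,
when the atlas is `Compatible`). [OURS · L1 W4.5c · SIG NP v2] -/
def npLocusA (𝔄 : NodeAtlasData p ρ g₀) : Set V :=
  {u | ∃ (i : 𝔄.ι) (hi : u ∈ (𝔄.O i).1), ¬ (𝔄.chart i).PrincipalAt u hi}

end Data

end NodeAtlas

/-! ## Port statements (kernel) -/

open NodeAtlas

/-- (NPA0) atlas data give today's Prop-valued atlas (so a `GModel` built with data still satisfies `atlas : NodeAtlas …`). -/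
def AtlasDataGivesAtlas (p : ℕ) : Prop :=
  ∀ ⦃V Y : Scheme.{0}⦄ (q : V ⟶ Y) (G : Type) [Group G] (ρ : ActionOver q G) (g₀ : G)
    (𝔄 : NodeAtlasData p ρ g₀), NodeAtlas.NodeAtlas p ρ g₀

/-- (NPA1) typed-bad points are atlas-np-bad: `M.badLocus ⊆ npLocusA 𝔄` for ANY atlas data on the model (no compatibility needed) —
proof: a chart principal at `u` localises (at the `σ`-fixed degree-`0` element) to principal node data on a stable affine neighbourhood of
`u`, and `isGoodAt_of_killedNode` applies. -/
def NpAContainsBad (p : ℕ) : Prop :=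
  ∀ ⦃X' X₁ : Scheme.{0}⦄ (q : X' ⟶ X₁) (G : Type) [Group G] [Finite G] (ρ : G →* Aut X') (g₀ : G),
    p.Prime → (∀ g : G, g ∈ Subgroup.zpowers g₀) →
    ∀ (M : GameFrame.GModel p q G ρ g₀) (𝔄 : NodeAtlasData p M.act g₀), M.badLocus ⊆ npLocusA 𝔄

/-- (NPA2) empty atlas-np-locus ⇒ terminal (end assembly unchanged). -/
def NpATerminal (p : ℕ) : Prop :=
  ∀ ⦃X' X₁ : Scheme.{0}⦄ (q : X' ⟶ X₁) (G : Type) [Group G] [Finite G] (ρ : G →* Aut X') (g₀ : G),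
    p.Prime → (∀ g : G, g ∈ Subgroup.zpowers g₀) →
    ∀ (M : GameFrame.GModel p q G ρ g₀) (𝔄 : NodeAtlasData p M.act g₀), npLocusA 𝔄 = ∅ → M.Terminal

/-- (NPA3) for a compatible atlas the locus is closed (locally it is the image of the closed non-principal locus of one chart's node ring
under the integral map `Spec B → O`) and `g₀`-stable. -/
def NpAClosedStable (p : ℕ) : Prop :=
  ∀ ⦃X' X₁ : Scheme.{0}⦄ (q : X' ⟶ X₁) (G : Type) [Group G] [Finite G] (ρ : G →* Aut X') (g₀ : G),
    ∀ (M : GameFrame.GModel p q G ρ g₀) (𝔄 : NodeAtlasData p M.act g₀), 𝔄.Compatible →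
      IsClosed (npLocusA 𝔄) ∧ ∀ u : M.V, (M.act.aut g₀).hom.base u ∈ npLocusA 𝔄 ↔ u ∈ npLocusA 𝔄

/-!
## Shape of the frame edit (lead-1, (K0-np); NOT declared here)
* `GModel` gains `𝔄 : NodeAtlasData p act g₀` and `compat : 𝔄.Compatible`; `atlas` becomes `AtlasDataGivesAtlas`.
* `IsMoveOf M M' 𝒦 d` additionally requires: every chart of `M'.𝔄` is compatible (same `PrincipalAt` at common points) with (i) the
  PRODUCER-STEP charts of the blow-up over a centre chart of `M` and (ii) the `π'`-pull-backs of the charts of `M.𝔄` off the exceptional locus;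
  `MoveStep` owes compatible data (both compatibilities are algebra: «principal at u» is invariant under localisation at `σ`-fixed degree-`0`
  elements and under graded `σ`-isomorphism).
* optional move ATLAS REFINEMENT (`M' = M`, `𝔄' ⊇ 𝔄` compatible): deletes multiplicative points via the Laurent node of SIG (M); or fold the
  Laurent refinements into the atlas each move produces — lead-1's choice.
* measure: `npJInfA M := topologicalKrullDim ↥(npLocusA M.𝔄 ∩ {v | ¬ KillableAt M v})` and the lex companion as today; K_np / A_np are the
  registered K / A statements read with `npLocusA M.𝔄` for `M.badLocus`.
-/

end Summit.ResolutionOfSingularities.ResolutionOfSingularities.Theorems.WildQuotientResolution.S1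

end
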